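import Summits.BirchSwinnertonDyer.BirchSwinnertonDyer.Theorems.ThetaPartnerAtTwoSignedControlAtTwoPlusDescentTwo
import HarnessLib

/-!
# The PLUS tower at `2`, VII: PLUS HONDA POINTS `e_M = c_M + ι·c_M ∈ E₁(ℚ₂(v_M))` with `Λ(e_M) ≡ v_M (mod ℚ₂(v_{M−1}))`, and the
# unconditional generation step along the plus tower
# (K4 `SignedControlAtTwo`, stmt-BirchSwinnertonDyer-20309, line `eulerchar` v6, stub HONDA⁺@2 (GEN) — memo LAGPLUS-AT-2 §2, §4)

Route `ThetaPartnerAtTwo` (TP2; shared with `ResidualThetaTransportAtTwo`), crux K4, lead seat `prover-bsd-wall-tp2-p3` (g2). Sequel of files V–VI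
(`…PlusGenStepTwo`, `…PlusDescentTwo`). INPUT: the K3 lead's all-primes tower points `c_m ∈ L(ℚ_p(ζ_{p^m})) ∩ E₁`, `Λ(c_m) = ℓ_m`
(`…LocalTowerPoints.exists_towerPoints`, any family with these properties), at `p = 2`.

WHAT (`Ω = ℚ̄₂`, `E = genFibΩ 2 M`, `E₁ = kernel`, `Λ = ptLogΩ`, `v_L = ζ_{2^L} + ζ_{2^L}⁻¹ − 2`, `N ≥ 2`; `ι ∈ Γ` with
`ι ζ_{2^{N+2}} = −ζ_{2^{N+2}}⁻¹` (`PlusTower.exists_tau`), so `ι ζ_{2^{N+1}} = ζ_{2^{N+1}}⁻¹`: the INVERSION of the layer `ℚ₂(ζ_{2^{N+1}})` over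
its plus field):
* §1 `act_add` (a coordinatewise Galois action is additive: it is Mathlib's `Point.map`), `smul_zeta_eq_inv_of`, `act_act_eq_self`
  (`ι²` fixes `L(ℚ₂(ζ_{2^{N+1}}))`);
* §2 descent from a layer to its plus field: `exists_eq_add_mul_zeta` (`ℚ₂(ζ_L) = ℚ₂(v_L) + ℚ₂(v_L)ζ_L`), `apply_eq_self_of_apply_v_eq`,
  **`mem_adjoin_v_of_inv_apply_eq`** (`x ∈ ℚ₂(ζ_L)`, `σζ_L = ζ_L⁻¹`, `σx = x ⇒ x ∈ ℚ₂(v_L)`), `mem_subfieldPoints_adjoin_v_of_inv_act_eq` (points);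
* §3 **`plusPoint_mem`**: for `c ∈ L(ℚ₂(ζ_{2^{N+1}})) ∩ E₁` with `Λ(c) = ℓ_{N+1}`, the point `e = c + ι·c` lies in `L(ℚ₂(v_{N+1})) ∩ E₁` and
  `Λ(e) − v_{N+1} ∈ ℚ₂(v_N)` (`Λ(e) = ℓ + ιℓ`, `ℓ − (ζ − 1) ∈ ℚ₂(ζ_{2^N})`, `ι`-invariants of `ℚ₂(ζ_{2^N})` = `ℚ₂(v_N)`) — the plus Honda
  point HYPOTHESIS of `exists_sub_closure_sub_two_smul_mem_plus`;
* §4 **`exists_sub_closure_sub_two_smul_mem_plus'`**: the GENERATION STEP along the plus tower with the K3 lead's tower points plugged in: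
  `a₂(M) = 0`, no `2`-power torsion in `L(ℚ₂(ζ_{2^{N+1}}))`, `N ≥ 2` ⇒ every `P ∈ L(ℚ₂(v_{N+1})) ∩ E₁` is `≡ B + 2•R (mod L(ℚ₂(v_N)) ∩ E₁)`
  with `B ∈ ℤ[Γ·e_{N+1}]` — clause (GEN) of HONDA⁺@2 in `Ω`-currency, now with NO point hypothesis.
HONEST FRAMING: THEOREMS ONLY (no definition, no named fact, no instance, no `sorry`); pure local theory; nothing about any Selmer group; closes no
item; BSD is not proved by any of this.

References: [Kobayashi2003] §8.4, Lemma 8.9, Props. 8.11–8.12; [Washington1997] §13.1, Prop. 2.16; [SilvermanAEC2009] VII.2.2.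
-/

set_option autoImplicit false
-- the Theorems namespace of this sub repeats the summit name by design (D-0017 nested layout)
set_option linter.dupNamespace false

noncomputable section

open scoped Classical Topology NNReal IntermediateField
open Filter PowerSeries Finset Polynomial

namespace Summit.BirchSwinnertonDyer.BirchSwinnertonDyer.Theorems.SignedEC.PlusTower

open Literature.RingTheory.FormalGroups WeierstrassCurve Field Field.absoluteGaloisGroup
open Summit.BirchSwinnertonDyer.Rank1Residual.Additive
open Summit.BirchSwinnertonDyer.Rank1Residual.Additive.PadicCyclotomicTower
open Summit.BirchSwinnertonDyer.Rank1Residual.Additive.HondaFss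
open Summit.BirchSwinnertonDyer.Rank1Residual.Additive.BallEval
open Literature.NumberTheory.GaloisRepresentations.LubinTate (unitBall mem_unitBall_iff)
open Literature.NumberTheory.EllipticCurves Literature.NumberTheory.EllipticCurves.FormalGroupChart
open Summit.BirchSwinnertonDyer.BirchSwinnertonDyer.Theorems.SignedKatoOffTwo.LocalAllPrimes
open Summit.BirchSwinnertonDyer.BirchSwinnertonDyer.Theorems.SignedEC.OmegaSubfield

/-! ## §1 Coordinatewise actions: additivity, the inversion `ι`, `ι² = 1` on the layer -/

section Act

variable {M : WeierstrassCurve ℤ_[2]}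

/-- A coordinatewise Galois action IS Mathlib's `Point.map` of the automorphism. [folklore] -/
theorem act_eq_map (act : absoluteGaloisGroup ℚ_[2] → (genFibΩ 2 M).toAffine.Point → (genFibΩ 2 M).toAffine.Point)
    (hact0 : ∀ σ, act σ 0 = 0)
    (hact : ∀ σ (x y : PadicAlgCl 2) (h : (genFibΩ 2 M).toAffine.Nonsingular x y),
      ∃ h', act σ (Affine.Point.some x y h) = Affine.Point.some (σ • x) (σ • y) h')
    (σ : absoluteGaloisGroup ℚ_[2]) (P : (genFibΩ 2 M).toAffine.Point) :
    act σ P = Affine.Point.map (W' := M.map (PadicInt.Coe.ringHom (p := 2)))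
      (toAlgEquiv ℚ_[2] σ : PadicAlgCl 2 →ₐ[ℚ_[2]] PadicAlgCl 2) P := by
  rcases P with _ | ⟨x, y, h⟩
  · change act σ 0 = _
    rw [hact0]; exact (map_zero _).symm
  · obtain ⟨h', e⟩ := hact σ x y h
    rw [e, Affine.Point.map_some]
    simp only [absoluteGaloisGroup.smul_def]
    rfl

/-- **A coordinatewise Galois action is additive.** [cite: SilvermanAEC2009, VII.2.2] -/
theorem act_add (act : absoluteGaloisGroup ℚ_[2] → (genFibΩ 2 M).toAffine.Point → (genFibΩ 2 M).toAffine.Point)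
    (hact0 : ∀ σ, act σ 0 = 0)
    (hact : ∀ σ (x y : PadicAlgCl 2) (h : (genFibΩ 2 M).toAffine.Nonsingular x y),
      ∃ h', act σ (Affine.Point.some x y h) = Affine.Point.some (σ • x) (σ • y) h')
    (σ : absoluteGaloisGroup ℚ_[2]) (P Q : (genFibΩ 2 M).toAffine.Point) : act σ (P + Q) = act σ P + act σ Q := by
  rw [act_eq_map act hact0 hact, act_eq_map act hact0 hact, act_eq_map act hact0 hact, map_add]

/-- From `σ ζ_{m+1} = ζ_{m+1}^{2^m + 2^{m+1} − 1}`: `σ ζ_m = ζ_m⁻¹` (the inversion on the layer below). [cite: Washington1997, §13.1] -/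
theorem apply_zeta_eq_inv_of {m : ℕ} {σ : PadicAlgCl 2 ≃ₐ[ℚ_[2]] PadicAlgCl 2}
    (h : σ (zeta 2 (m + 1)) = zeta 2 (m + 1) ^ (2 ^ m + (2 ^ (m + 1) - 1))) : σ (zeta 2 m) = (zeta 2 m)⁻¹ := by
  have h2 := apply_zeta_of_apply_zeta_succ h
  have hN : zeta 2 m ^ 2 ^ m = 1 := (isPrimitiveRoot_zeta 2 m).pow_eq_one
  rw [h2]
  refine eq_inv_of_mul_eq_one_left ?_
  rw [← pow_succ]
  have : 2 ^ m + (2 ^ (m + 1) - 1) + 1 = 2 ^ m * 3 := by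
    have h1 : 1 ≤ 2 ^ (m + 1) := Nat.one_le_two_pow
    rw [pow_succ] at h1 ⊢; omega
  rw [this, pow_mul, hN, one_pow]

/-- `σ²` fixes `ζ_m` when `σ ζ_m = ζ_m⁻¹`; hence `σ² ∈ stab m`. [folklore] -/
theorem mul_self_mem_stab {m : ℕ} {g : absoluteGaloisGroup ℚ_[2]} (hg : toAlgEquiv ℚ_[2] g (zeta 2 m) = (zeta 2 m)⁻¹) :
    g * g ∈ stab 2 m := by
  rw [mem_stab_iff, mul_smul, absoluteGaloisGroup.smul_def, absoluteGaloisGroup.smul_def, hg, map_inv₀, hg, inv_inv]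

/-- `act g (act g Q) = Q` on `L(layer m)` when `g` inverts `ζ_m`. [folklore] -/
theorem act_act_eq_self (act : absoluteGaloisGroup ℚ_[2] → (genFibΩ 2 M).toAffine.Point → (genFibΩ 2 M).toAffine.Point)
    (hact0 : ∀ σ, act σ 0 = 0)
    (hact : ∀ σ (x y : PadicAlgCl 2) (h : (genFibΩ 2 M).toAffine.Nonsingular x y),
      ∃ h', act σ (Affine.Point.some x y h) = Affine.Point.some (σ • x) (σ • y) h')
    {m : ℕ} {g : absoluteGaloisGroup ℚ_[2]} (hg : toAlgEquiv ℚ_[2] g (zeta 2 m) = (zeta 2 m)⁻¹)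
    {Q : (genFibΩ 2 M).toAffine.Point} (hQ : Q ∈ subfieldPoints (genFibΩ 2 M) (layer 2 m).toSubfield coeffs_mem_layer) :
    act g (act g Q) = Q := by
  rcases Q with _ | ⟨x, y, h⟩
  · change act g (act g 0) = 0
    rw [hact0, hact0]
  · obtain ⟨hx, hy⟩ := (some_mem_subfieldPoints_iff _ h).mp hQ
    obtain ⟨h', e⟩ := hact g x y h
    obtain ⟨h'', e'⟩ := hact g (g • x) (g • y) h'
    rw [e, e']
    have hgg := mul_self_mem_stab hg
    simp only [smul_smul, smul_eq_self_of_mem_stab hgg hx, smul_eq_self_of_mem_stab hgg hy]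

end Act

/-! ## §2 Descent from the layer `ℚ₂(ζ_{2^L})` to its plus field `ℚ₂(v_L)` -/

/-- **`ℚ₂(ζ_L) = ℚ₂(v_L) + ℚ₂(v_L)·ζ_L`**: every `x ∈ layer 2 L` is `A + B ζ_L` with `A, B ∈ ℚ₂(v_L)` (`x = r(ζ)`, `ζ² = (v_L + 2)ζ − 1`).
[cite: Washington1997, Prop. 2.16] -/
theorem exists_eq_add_mul_zeta {L : ℕ} {x : PadicAlgCl 2} (hx : x ∈ layer 2 L) :
    ∃ A ∈ ℚ_[2]⟮zeta 2 L + (zeta 2 L)⁻¹ - 2⟯, ∃ B ∈ ℚ_[2]⟮zeta 2 L + (zeta 2 L)⁻¹ - 2⟯, x = A + B * zeta 2 L := by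
  set ζ := zeta 2 L with hζ
  set K := ℚ_[2]⟮ζ + ζ⁻¹ - 2⟯ with hK
  have hζ0 : ζ ≠ 0 := zeta_ne_zero L
  have huK : ζ + ζ⁻¹ ∈ K := by
    have h := IntermediateField.mem_adjoin_simple_self ℚ_[2] (ζ + ζ⁻¹ - 2)
    rw [show ζ + ζ⁻¹ = (ζ + ζ⁻¹ - 2) + 2 by ring]
    exact add_mem h (by exact_mod_cast IntermediateField.natCast_mem K 2)
  have hsq : ζ ^ 2 = (ζ + ζ⁻¹) * ζ - 1 := by field_simp; ring
  -- powers of `ζ`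
  have hpow : ∀ j : ℕ, ∃ A ∈ K, ∃ B ∈ K, ζ ^ j = A + B * ζ := by
    intro j
    induction j with
    | zero => exact ⟨1, one_mem K, 0, zero_mem K, by rw [pow_zero, zero_mul, add_zero]⟩
    | succ j ih =>
      obtain ⟨A, hA, B, hB, hj⟩ := ih
      refine ⟨-B, neg_mem hB, A + B * (ζ + ζ⁻¹), add_mem hA (mul_mem hB huK), ?_⟩
      rw [pow_succ, hj]
      linear_combination B * hsq
  obtain ⟨r, -, hrx⟩ := exists_aeval_zeta_eq 2 hx
  choose A hA B hB hAB using hpow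
  refine ⟨∑ j ∈ Finset.range (r.natDegree + 1), r.coeff j • A j, sum_mem fun j _ ↦ IntermediateField.smul_mem K (hA j),
    ∑ j ∈ Finset.range (r.natDegree + 1), r.coeff j • B j, sum_mem fun j _ ↦ IntermediateField.smul_mem K (hB j), ?_⟩
  rw [← hrx, aeval_eq_sum_range, Finset.sum_mul, ← Finset.sum_add_distrib]
  refine Finset.sum_congr rfl fun j _ ↦ ?_
  rw [← hζ, hAB j, smul_add, smul_mul_assoc]

/-- An automorphism fixing `v_L` fixes `ℚ₂(v_L)` pointwise (`L ≥ 2`). [folklore] -/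
theorem apply_eq_self_of_apply_v_eq {L : ℕ} (hL : 2 ≤ L) {σ : PadicAlgCl 2 ≃ₐ[ℚ_[2]] PadicAlgCl 2}
    (hσ : σ (zeta 2 L + (zeta 2 L)⁻¹ - 2) = zeta 2 L + (zeta 2 L)⁻¹ - 2) {y : PadicAlgCl 2}
    (hy : y ∈ ℚ_[2]⟮zeta 2 L + (zeta 2 L)⁻¹ - 2⟯) : σ y = y := by
  obtain ⟨r, -, rfl⟩ := exists_aeval_v_eq hL hy
  conv_rhs => rw [aeval_eq_sum_range]
  rw [aeval_eq_sum_range, map_sum]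
  refine Finset.sum_congr rfl fun i _ ↦ ?_
  rw [Algebra.smul_def, map_mul, map_pow, AlgEquiv.commutes, hσ]

/-- **Field descent layer → plus field**: `x ∈ ℚ₂(ζ_L)`, `σζ_L = ζ_L⁻¹`, `σx = x` ⇒ `x ∈ ℚ₂(v_L)` (`L ≥ 2`: `x = A + Bζ`,
`σx = A + Bζ⁻¹`, `ζ ≠ ζ⁻¹`). [cite: Washington1997, Prop. 2.16] -/
theorem mem_adjoin_v_of_inv_apply_eq {L : ℕ} (hL : 2 ≤ L) {σ : PadicAlgCl 2 ≃ₐ[ℚ_[2]] PadicAlgCl 2}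
    (hσ : σ (zeta 2 L) = (zeta 2 L)⁻¹) {x : PadicAlgCl 2} (hx : x ∈ layer 2 L) (hfix : σ x = x) :
    x ∈ ℚ_[2]⟮zeta 2 L + (zeta 2 L)⁻¹ - 2⟯ := by
  obtain ⟨A, hA, B, hB, rfl⟩ := exists_eq_add_mul_zeta hx
  have hσv : σ (zeta 2 L + (zeta 2 L)⁻¹ - 2) = zeta 2 L + (zeta 2 L)⁻¹ - 2 := by
    rw [map_sub, map_ofNat, map_add, map_inv₀, hσ, inv_inv]; ring
  rw [map_add, map_mul, apply_eq_self_of_apply_v_eq hL hσv hA, apply_eq_self_of_apply_v_eq hL hσv hB, hσ] at hfix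
  have hB0 : B * ((zeta 2 L)⁻¹ - zeta 2 L) = 0 := by linear_combination hfix
  rcases mul_eq_zero.mp hB0 with hB0 | hz
  · rw [hB0, zero_mul, add_zero]; exact hA
  · exfalso
    have hζ0 : zeta 2 L ≠ 0 := zeta_ne_zero L
    have hsq : zeta 2 L ^ 2 = 1 := by
      have h1 : (zeta 2 L)⁻¹ = zeta 2 L := sub_eq_zero.mp hz
      have h2 := congrArg (· * zeta 2 L) h1
      simp only [inv_mul_cancel₀ hζ0] at h2
      rw [pow_two]; exact h2.symm
    have hdvd := ((isPrimitiveRoot_zeta 2 L).pow_eq_one_iff_dvd 2).mp hsq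
    have h4 : 4 ≤ 2 ^ L := by
      calc 4 = 2 ^ 2 := by norm_num
        _ ≤ 2 ^ L := Nat.pow_le_pow_right (by norm_num) hL
    exact absurd (Nat.le_of_dvd two_pos hdvd) (by omega)

/-- **Point descent layer → plus field**: a point of `L(ℚ₂(ζ_L))` fixed by an action inverting `ζ_L` lies in `L(ℚ₂(v_L))`. [folklore] -/
theorem mem_subfieldPoints_adjoin_v_of_inv_act_eq {M : WeierstrassCurve ℤ_[2]}
    (act : absoluteGaloisGroup ℚ_[2] → (genFibΩ 2 M).toAffine.Point → (genFibΩ 2 M).toAffine.Point)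
    (hact : ∀ σ (x y : PadicAlgCl 2) (h : (genFibΩ 2 M).toAffine.Nonsingular x y),
      ∃ h', act σ (Affine.Point.some x y h) = Affine.Point.some (σ • x) (σ • y) h')
    {L : ℕ} (hL : 2 ≤ L) {g : absoluteGaloisGroup ℚ_[2]} (hg : toAlgEquiv ℚ_[2] g (zeta 2 L) = (zeta 2 L)⁻¹)
    {Q : (genFibΩ 2 M).toAffine.Point} (hQ : Q ∈ subfieldPoints (genFibΩ 2 M) (layer 2 L).toSubfield coeffs_mem_layer)
    (hfix : act g Q = Q) :
    Q ∈ subfieldPoints (genFibΩ 2 M) (ℚ_[2]⟮zeta 2 L + (zeta 2 L)⁻¹ - 2⟯).toSubfield (coeffs_mem_adjoin M _) := by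
  rcases Q with _ | ⟨x, y, h⟩
  · exact (subfieldPoints _ _ _).zero_mem
  · obtain ⟨h', e⟩ := hact g x y h
    obtain ⟨hx, hy⟩ := (some_mem_subfieldPoints_iff _ h).mp hQ
    rw [e] at hfix
    have hxy := (Affine.Point.some.injEq _ _ _ _ _ _).mp hfix
    rw [absoluteGaloisGroup.smul_def, absoluteGaloisGroup.smul_def] at hxy
    exact (some_mem_subfieldPoints_iff _ h).mpr
      ⟨mem_adjoin_v_of_inv_apply_eq hL hg hx hxy.1, mem_adjoin_v_of_inv_apply_eq hL hg hy hxy.2⟩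

/-! ## §3 The plus Honda point `e = c + ι·c` -/

section PlusPoint

variable {M : WeierstrassCurve ℤ_[2]} [hE : (M.map PadicInt.Coe.ringHom).IsElliptic]
  [hintΩ : (genFibΩ 2 M).IsIntegral (Valued.v (R := PadicAlgCl 2)).integer]

/-- **THE PLUS HONDA POINT.** For `N ≥ 2`, `ι ∈ Γ` with `ι ζ_{2^{N+2}} = −ζ_{2^{N+2}}⁻¹` (so `ι` inverts `ζ_{2^{N+1}}`), and a tower point
`c ∈ L(ℚ₂(ζ_{2^{N+1}})) ∩ E₁` with `Λ(c) = ℓ_{N+1}`: the point `e = c + ι·c` lies in `L(ℚ₂(v_{N+1})) ∩ E₁` and `Λ(e) − v_{N+1} ∈ ℚ₂(v_N)`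
(`Λ(e) = ℓ + ιℓ ≡ (ζ − 1) + (ζ⁻¹ − 1) = v_{N+1}` modulo the `ι`-invariants of `ℚ₂(ζ_{2^N})`, which form `ℚ₂(v_N)`). This is the memo's
`e_n = Tr_{ℚ₂(ζ_{2^{n+2}})/k_n} c` (LAGPLUS-AT-2 §2) in `Ω`-currency. [cite: Kobayashi2003, Lemma 8.9] -/
theorem plusPoint_mem
    (act : absoluteGaloisGroup ℚ_[2] → (genFibΩ 2 M).toAffine.Point → (genFibΩ 2 M).toAffine.Point)
    (hact0 : ∀ σ, act σ 0 = 0)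
    (hact : ∀ σ (x y : PadicAlgCl 2) (h : (genFibΩ 2 M).toAffine.Nonsingular x y),
      ∃ h', act σ (Affine.Point.some x y h) = Affine.Point.some (σ • x) (σ • y) h')
    {N : ℕ} (hN : 2 ≤ N) {ι : absoluteGaloisGroup ℚ_[2]}
    (hι : toAlgEquiv ℚ_[2] ι (zeta 2 (N + 2)) = zeta 2 (N + 2) ^ (2 ^ (N + 1) + (2 ^ (N + 2) - 1)))
    {c : (genFibΩ 2 M).toAffine.Point} (hcL : c ∈ subfieldPoints (genFibΩ 2 M) (layer 2 (N + 1)).toSubfield coeffs_mem_layer)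
    (hck : c ∈ kernel (Valued.v (R := PadicAlgCl 2)) (genFibΩ 2 M)) (hcℓ : ptLogΩ 2 M c = ell 2 (N + 1)) :
    c + act ι c ∈ subfieldPoints (genFibΩ 2 M) (ℚ_[2]⟮zeta 2 (N + 1) + (zeta 2 (N + 1))⁻¹ - 2⟯).toSubfield
        (coeffs_mem_adjoin M _) ∧
      c + act ι c ∈ kernel (Valued.v (R := PadicAlgCl 2)) (genFibΩ 2 M) ∧
      ptLogΩ 2 M (c + act ι c) - (zeta 2 (N + 1) + (zeta 2 (N + 1))⁻¹ - 2) ∈ ℚ_[2]⟮zeta 2 N + (zeta 2 N)⁻¹ - 2⟯ := by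
  haveI := isIntegral_curveK 2 (LayerField 2 (N + 1)) M
  have hιζ : toAlgEquiv ℚ_[2] ι (zeta 2 (N + 1)) = (zeta 2 (N + 1))⁻¹ := apply_zeta_eq_inv_of hι
  have hιζN : toAlgEquiv ℚ_[2] ι (zeta 2 N) = (zeta 2 N)⁻¹ := by
    rw [← zeta_succ_pow 2 N, map_pow, hιζ, inv_pow]
  have hιcL := act_mem_subfieldPoints act hact0 hact ι hcL
  have hιck : act ι c ∈ kernel (Valued.v (R := PadicAlgCl 2)) (genFibΩ 2 M) := act_mem_kernel act hact0 hact ι hck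
  have heL : c + act ι c ∈ subfieldPoints (genFibΩ 2 M) (layer 2 (N + 1)).toSubfield coeffs_mem_layer :=
    (subfieldPoints _ _ _).add_mem hcL hιcL
  have hek : c + act ι c ∈ kernel (Valued.v (R := PadicAlgCl 2)) (genFibΩ 2 M) :=
    (kernel (Valued.v (R := PadicAlgCl 2)) (genFibΩ 2 M)).add_mem hck hιck
  -- `ι e = e`, hence `e ∈ L(ℚ₂(v_{N+1}))`
  have hfix : act ι (c + act ι c) = c + act ι c := by
    rw [act_add act hact0 hact, act_act_eq_self act hact0 hact hιζ hcL, add_comm]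
  refine ⟨mem_subfieldPoints_adjoin_v_of_inv_act_eq act hact (by omega) hιζ heL hfix, hek, ?_⟩
  -- the logarithm
  have hcz : ‖c.zCoord‖ < 1 := by
    have := val_zCoord_lt_one hck
    rwa [PadicAlgCl.valuation_def, ← NNReal.coe_lt_coe, coe_nnnorm, NNReal.coe_one] at this
  rw [ptLogΩ_add (m := N + 1) hcL hιcL hck hιck, ptLogΩ_act act hact0 hact ι hcz, hcℓ]
  set w := ell 2 (N + 1) - (zeta 2 (N + 1) - 1) with hw
  have hwL : w ∈ layer 2 N := by
    have := ell_sub_mem_layer_pred (p := 2) (m := N + 1) (by omega)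
    rwa [show N + 1 - 1 = N by omega] at this
  have e : ell 2 (N + 1) + ι • ell 2 (N + 1) - (zeta 2 (N + 1) + (zeta 2 (N + 1))⁻¹ - 2) = w + ι • w := by
    rw [hw, smul_sub, smul_sub, smul_one, absoluteGaloisGroup.smul_def ι (zeta 2 (N + 1)), hιζ]
    ring
  rw [e]
  -- `w + ι w` is an `ι`-invariant element of `layer N`
  have hmem : w + ι • w ∈ layer 2 N := add_mem hwL (smul_mem_layer ι hwL)
  refine mem_adjoin_v_of_inv_apply_eq hN hιζN hmem ?_
  rw [map_add, ← absoluteGaloisGroup.smul_def, ← absoluteGaloisGroup.smul_def, smul_smul,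
    smul_eq_self_of_mem_stab (mul_self_mem_stab hιζN) hwL, add_comm]

/-! ## §4 The generation step along the plus tower, unconditionally in the points -/

variable [hEt : (M.map PadicInt.toZMod).IsElliptic]

/-- **KOBAYASHI'S GENERATION STEP ALONG THE PLUS TOWER AT `p = 2` — with the tower points plugged in.** `M/ℤ₂` with elliptic fibres and
`a₂(M) = 0`; `N ≥ 2`; no `2`-power torsion in `L(ℚ₂(ζ_{2^{N+1}}))`; `ι` as in `plusPoint_mem`; `c` the family of `exists_towerPoints` (or any
`c ∈ L(ℚ₂(ζ_{2^{N+1}})) ∩ E₁` with `Λ(c) = ℓ_{N+1}`). Then every `P ∈ L(ℚ₂(v_{N+1})) ∩ E₁` satisfies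
`P − B − 2•R ∈ L(ℚ₂(v_N)) ∩ E₁` for some `B ∈ ℤ[Γ·(c + ι·c)]`, `R ∈ L(ℚ₂(v_{N+1})) ∩ E₁`. [cite: Kobayashi2003, Prop. 8.12] -/
theorem exists_sub_closure_sub_two_smul_mem_plus'
    (htr : Literature.NumberTheory.EllipticCurves.HasseManin.tr (M.map PadicInt.toZMod) = 0)
    (act : absoluteGaloisGroup ℚ_[2] → (genFibΩ 2 M).toAffine.Point → (genFibΩ 2 M).toAffine.Point)
    (hact0 : ∀ σ, act σ 0 = 0)
    (hact : ∀ σ (x y : PadicAlgCl 2) (h : (genFibΩ 2 M).toAffine.Nonsingular x y),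
      ∃ h', act σ (Affine.Point.some x y h) = Affine.Point.some (σ • x) (σ • y) h')
    {N : ℕ} (hN : 2 ≤ N)
    (htors : ∀ Q ∈ subfieldPoints (genFibΩ 2 M) (layer 2 (N + 1)).toSubfield coeffs_mem_layer, ∀ k : ℕ, 2 ^ k • Q = 0 → Q = 0)
    {ι : absoluteGaloisGroup ℚ_[2]}
    (hι : toAlgEquiv ℚ_[2] ι (zeta 2 (N + 2)) = zeta 2 (N + 2) ^ (2 ^ (N + 1) + (2 ^ (N + 2) - 1)))
    {c : (genFibΩ 2 M).toAffine.Point} (hcL : c ∈ subfieldPoints (genFibΩ 2 M) (layer 2 (N + 1)).toSubfield coeffs_mem_layer)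
    (hck : c ∈ kernel (Valued.v (R := PadicAlgCl 2)) (genFibΩ 2 M)) (hcℓ : ptLogΩ 2 M c = ell 2 (N + 1))
    {P : (genFibΩ 2 M).toAffine.Point}
    (hP : P ∈ subfieldPoints (genFibΩ 2 M) (ℚ_[2]⟮zeta 2 (N + 1) + (zeta 2 (N + 1))⁻¹ - 2⟯).toSubfield
      (coeffs_mem_adjoin M _))
    (hPk : P ∈ kernel (Valued.v (R := PadicAlgCl 2)) (genFibΩ 2 M)) :
    ∃ B ∈ AddSubgroup.closure (Set.range fun σ : absoluteGaloisGroup ℚ_[2] ↦ act σ (c + act ι c)),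
      ∃ R ∈ subfieldPoints (genFibΩ 2 M) (ℚ_[2]⟮zeta 2 (N + 1) + (zeta 2 (N + 1))⁻¹ - 2⟯).toSubfield
          (coeffs_mem_adjoin M _),
        R ∈ kernel (Valued.v (R := PadicAlgCl 2)) (genFibΩ 2 M) ∧
        P - B - 2 • R ∈ subfieldPoints (genFibΩ 2 M) (ℚ_[2]⟮zeta 2 N + (zeta 2 N)⁻¹ - 2⟯).toSubfield
          (coeffs_mem_adjoin M _) ∧
        P - B - 2 • R ∈ kernel (Valued.v (R := PadicAlgCl 2)) (genFibΩ 2 M) := by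
  obtain ⟨heL, hek, heℓ⟩ := plusPoint_mem act hact0 hact hN hι hcL hck hcℓ
  exact exists_sub_closure_sub_two_smul_mem_plus htr act hact0 hact hN htors heL hek heℓ hP hPk

/-- **Existence form**: with the K3 lead's tower points (`exists_towerPoints`, every prime) and `PlusTower.exists_tau`, for every `N ≥ 2`
there IS a plus Honda point `e ∈ L(ℚ₂(v_{N+1})) ∩ E₁` with `Λ(e) − v_{N+1} ∈ ℚ₂(v_N)`. [cite: Kobayashi2003, Lemma 8.9] -/
theorem exists_plusPoint
    (htr : Literature.NumberTheory.EllipticCurves.HasseManin.tr (M.map PadicInt.toZMod) = 0)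
    (act : absoluteGaloisGroup ℚ_[2] → (genFibΩ 2 M).toAffine.Point → (genFibΩ 2 M).toAffine.Point)
    (hact0 : ∀ σ, act σ 0 = 0)
    (hact : ∀ σ (x y : PadicAlgCl 2) (h : (genFibΩ 2 M).toAffine.Nonsingular x y),
      ∃ h', act σ (Affine.Point.some x y h) = Affine.Point.some (σ • x) (σ • y) h')
    {N : ℕ} (hN : 2 ≤ N) :
    ∃ e ∈ subfieldPoints (genFibΩ 2 M) (ℚ_[2]⟮zeta 2 (N + 1) + (zeta 2 (N + 1))⁻¹ - 2⟯).toSubfield (coeffs_mem_adjoin M _),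
      e ∈ kernel (Valued.v (R := PadicAlgCl 2)) (genFibΩ 2 M) ∧
      ptLogΩ 2 M e - (zeta 2 (N + 1) + (zeta 2 (N + 1))⁻¹ - 2) ∈ ℚ_[2]⟮zeta 2 N + (zeta 2 N)⁻¹ - 2⟯ := by
  obtain ⟨c, -, hc⟩ := exists_towerPoints 2 M htr
  obtain ⟨τ, hτ⟩ := exists_tau (by omega : 1 ≤ N + 1)
  set ι : absoluteGaloisGroup ℚ_[2] := (toAlgEquiv ℚ_[2]).symm τ with hιdef
  have hι : toAlgEquiv ℚ_[2] ι (zeta 2 (N + 2)) = zeta 2 (N + 2) ^ (2 ^ (N + 1) + (2 ^ (N + 2) - 1)) := by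
    rw [hιdef, MulEquiv.apply_symm_apply]; exact hτ
  obtain ⟨hcL, hck, hcℓ⟩ := hc (N + 1)
  obtain ⟨heL, hek, heℓ⟩ := plusPoint_mem act hact0 hact hN hι hcL hck hcℓ
  exact ⟨_, heL, hek, heℓ⟩

end PlusPoint

end Summit.BirchSwinnertonDyer.BirchSwinnertonDyer.Theorems.SignedEC.PlusTower

end
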